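import Literature.Geometry.DiscreteGeometry.ThreePointBoundGeneral
import Literature.Analysis.SpecialFunctions.ChebyshevHomPositivity
import HarnessLib

/-!
# Bachoc–Vallentin three-point positivity on `S²` (dimension `n = 3`)

The case `n = 3` of Bachoc–Vallentin's Corollary 3.5 ((pos Y), (pos S)), which the general file
`ThreePointKernelGeneral` (all `n ≥ 4`) leaves out: for `S² ⊂ ℝ³` the hyperplane `e^⊥` is a plane,
and the inner zonal kernels are the Chebyshev kernels of `S¹` (Gegenbauer parameter `(n-3)/2 = 0`),
taken in the bivariate homogeneous normalisation
`Q3 k u v t = T^{hom}_k(2(t - uv), (1-u²)(1-v²)) = ((1-u²)(1-v²))^{k/2} T_k((t-uv)/√((1-u²)(1-v²)))`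
(`Literature.Analysis.SpecialFunctions.chebHom`). Positivity around a pole comes from
`sum_mul_chebHom_nonneg` (the sum is `|Σ_j c_j z_j^k|²` after identifying `e^⊥ ≅ ℂ`).
These are the kernels behind the three-point SDP bounds for codes on `S²` (Tammes problem,
`A(3, θ)`; Bachoc–Vallentin ISIT 2007 Table 5.3).

## References
* C. Bachoc, F. Vallentin, J. Amer. Math. Soc. 21 (2008) 909–924, §3: Theorem 3.2, Corollary 3.5. [`BachocVallentin2007`]
* I. J. Schoenberg, Duke Math. J. 9 (1942), Theorem 1. [`Schoenberg1942`]
-/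

noncomputable section

open Finset Complex
open scoped RealInnerProductSpace ComplexConjugate

namespace Literature.Geometry.DiscreteGeometry

namespace BachocVallentin

open Literature.Analysis.SpecialFunctions

/-- Bachoc–Vallentin's three-point kernel for `S² ⊂ ℝ³` (homogeneous Chebyshev normalisation):
`Q3 k u v t = T^{hom}_k(2(t - uv), (1-u²)(1-v²))`. [cite: BachocVallentin2007, Theorem 3.2 (n = 3: P_k^{2} = T_k)] -/
def Q3 (k : ℕ) (u v t : ℝ) : ℝ :=
  chebHom k (2 * (t - u * v)) ((1 - u ^ 2) * (1 - v ^ 2))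

/-- **(pos Y) on `S²`: positivity of the three-point kernel around a pole, `n = 3`, all degrees `k`**:
for a unit vector `e ∈ ℝ³`, unit vectors `p_i` and real weights `c_i`,
`Σ_{i,j} c_i c_j Q3 k (e·p_i) (e·p_j) (p_i·p_j) ≥ 0`. [cite: BachocVallentin2007, Corollary 3.5] -/
theorem sum_sum_Q3_nonneg (k : ℕ) (e : EuclideanSpace ℝ (Fin 3)) (he : ‖e‖ = 1)
    {ι : Type*} (s : Finset ι) (c : ι → ℝ) (p : ι → EuclideanSpace ℝ (Fin 3))
    (hp : ∀ i ∈ s, ‖p i‖ = 1) :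
    0 ≤ ∑ i ∈ s, ∑ j ∈ s,
      c i * c j * Q3 k (inner ℝ e (p i)) (inner ℝ e (p j)) (inner ℝ (p i) (p j)) := by
  classical
  obtain ⟨φ, hφ⟩ := exists_hyperplane_coords (n := 3) (by norm_num) e he
  have hφsq : ∀ x : EuclideanSpace ℝ (Fin 3), ‖x‖ = 1 → ∑ j, φ x j ^ 2 = 1 - inner ℝ e x ^ 2 := by
    intro x hx
    have h := hφ x x
    simp only [← sq] at h
    rw [h, real_inner_self_eq_norm_sq, hx]; ring
  -- identify `e^⊥ ≅ ℝ² ≅ ℂ`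
  let z : ι → ℂ := fun i => ⟨φ (p i) 0, φ (p i) 1⟩
  have hre : ∀ i j, (conj (z i) * z j).re = ∑ l, φ (p i) l * φ (p j) l := by
    intro i j
    rw [Fin.sum_univ_two]
    simp [z, Complex.mul_re, Complex.conj_re, Complex.conj_im]
  have hnsq : ∀ i, normSq (z i) = ∑ l, φ (p i) l ^ 2 := by
    intro i
    rw [Fin.sum_univ_two, Complex.normSq_apply]
    simp [z, sq]
  have key := sum_mul_chebHom_nonneg s k z c
  have hterm : ∀ i ∈ s, ∀ j ∈ s,
      c i * c j * chebHom k (2 * (conj (z i) * z j).re) (normSq (z i) * normSq (z j)) =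
      c i * c j * Q3 k (inner ℝ e (p i)) (inner ℝ e (p j)) (inner ℝ (p i) (p j)) := by
    intro i hi j hj
    rw [hre, hnsq, hnsq, hφ, hφsq _ (hp i hi), hφsq _ (hp j hj), Q3]
  calc (0 : ℝ) ≤ ∑ i ∈ s, ∑ j ∈ s,
        c i * c j * chebHom k (2 * (conj (z i) * z j).re) (normSq (z i) * normSq (z j)) := key
    _ = ∑ i ∈ s, ∑ j ∈ s,
        c i * c j * Q3 k (inner ℝ e (p i)) (inner ℝ e (p j)) (inner ℝ (p i) (p j)) :=
      Finset.sum_congr rfl fun i hi => Finset.sum_congr rfl fun j hj => hterm i hi j hj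

/-- **(pos S) on `S²`, rank-one form**: for a finite set `C` of unit vectors of `ℝ³`, any weight
function `g` and every `k`, `Σ_{x,y,z ∈ C} g(x·y) g(x·z) Q3 k (x·y) (x·z) (y·z) ≥ 0`.
[cite: BachocVallentin2007, Corollary 3.5] -/
theorem tripleSum_weight_nonneg3 (k : ℕ) (g : ℝ → ℝ)
    (C : Finset (EuclideanSpace ℝ (Fin 3))) (hC : ∀ x ∈ C, ‖x‖ = 1) :
    0 ≤ tripleSum C (fun u v t => g u * g v * Q3 k u v t) := by
  unfold tripleSum
  refine Finset.sum_nonneg fun x hx => ?_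
  exact sum_sum_Q3_nonneg k x (hC x hx) C (fun y => g (inner ℝ x y)) (fun y => y) hC

/-- **(pos S) on `S²`, symmetrised rank-one form**: the triple sum of
`sym6 (g(u) g(v) Q3 k (u,v,t))` is `≥ 0`. [cite: BachocVallentin2007, Corollary 3.5] -/
theorem tripleSum_sym6_weight_nonneg3 (k : ℕ) (g : ℝ → ℝ)
    (C : Finset (EuclideanSpace ℝ (Fin 3))) (hC : ∀ x ∈ C, ‖x‖ = 1) :
    0 ≤ tripleSum C (sym6 fun u v t => g u * g v * Q3 k u v t) := by
  rw [tripleSum_sym6]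
  exact mul_nonneg (by norm_num) (tripleSum_weight_nonneg3 k g C hC)

/-! ### Theorem 4.2 on `S²` for certificates (the `n = 3` companion of `card_le_of_certificate`) -/

/-- The three-point function of an `S²` certificate in factored form:
`F(u,v,t) = Σ_{k<K} Σ_{r<R} d_{k,r} · sym6 (g_{k,r}(u) g_{k,r}(v) Q3 k (u,v,t))`.
[cite: BachocVallentin2007, Theorem 4.2 (the function Σ_k ⟨F_k, S_k^n⟩, n = 3)] -/
def threePointF3 (K R : ℕ) (d : ℕ → ℕ → ℝ) (g : ℕ → ℕ → ℝ → ℝ) (u v t : ℝ) : ℝ :=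
  ∑ k ∈ range K, ∑ r ∈ range R, d k r * sym6 (fun u v t => g k r u * g k r v * Q3 k u v t) u v t

/-- `threePointF3` is symmetric in its first two arguments. [cite: BachocVallentin2007, Corollary 3.5 (S_k^n symmetric)] -/
theorem threePointF3_swap12 (K R : ℕ) (d : ℕ → ℕ → ℝ) (g : ℕ → ℕ → ℝ → ℝ) (u v t : ℝ) :
    threePointF3 K R d g u v t = threePointF3 K R d g v u t := by
  unfold threePointF3
  refine Finset.sum_congr rfl fun k _ => Finset.sum_congr rfl fun r _ => ?_
  rw [sym6_swap12]

/-- `threePointF3` is symmetric in its last two arguments. [cite: BachocVallentin2007, Corollary 3.5 (S_k^n symmetric)] -/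
theorem threePointF3_swap23 (K R : ℕ) (d : ℕ → ℕ → ℝ) (g : ℕ → ℕ → ℝ → ℝ) (u v t : ℝ) :
    threePointF3 K R d g u v t = threePointF3 K R d g u t v := by
  unfold threePointF3
  refine Finset.sum_congr rfl fun k _ => Finset.sum_congr rfl fun r _ => ?_
  rw [sym6_swap23]

/-- **(pos S) for an `S²` certificate's three-point function:** `Σ_{x,y,z ∈ C} F ≥ 0` for
`F = threePointF3 K R d g` with `d ≥ 0`, `C ⊂ S²` finite. [cite: BachocVallentin2007, Corollary 3.5] -/
theorem tripleSum_threePointF3_nonneg (K R : ℕ) (d : ℕ → ℕ → ℝ)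
    (hd : ∀ k r, 0 ≤ d k r) (g : ℕ → ℕ → ℝ → ℝ) (C : Finset (EuclideanSpace ℝ (Fin 3)))
    (hC : ∀ x ∈ C, ‖x‖ = 1) :
    0 ≤ tripleSum C (threePointF3 K R d g) := by
  unfold threePointF3
  rw [tripleSum_finset_sum]
  refine Finset.sum_nonneg fun k _ => ?_
  rw [tripleSum_finset_sum]
  refine Finset.sum_nonneg fun r _ => ?_
  rw [tripleSum_smul]
  exact mul_nonneg (hd k r) (tripleSum_sym6_weight_nonneg3 k (g k r) C hC)

/-- **Bachoc–Vallentin, Theorem 4.2 on `S²` (dimension `n = 3`), every angle:** let `C` be a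
finite set of unit vectors of `ℝ³` with pairwise inner products `≤ s`; let `a_k ≥ 0`,
`A(u) = Σ_{k ≤ deg} a_k C_k^{1/2}(u)` (Legendre), `F = threePointF3 K R d g` with `d_{k,r} ≥ 0`,
`b₁₁, b₂₂ ≥ 0`, `b₁₂² ≤ b₁₁ b₂₂`. If (i) `A(u) + 3F(u,u,1) ≤ -1 - 2b₁₂ - b₂₂` on `[-1, s]` and
(ii) `F(u,v,t) ≤ -b₂₂` on `D'`, then `|C| ≤ 1 + A(1) + b₁₁ + F(1,1,1)` — the bound behind the
Tammes / `A(3, θ)` tables (BV ISIT 2007 Table 5.3). [cite: BachocVallentin2007, Theorem 4.2] -/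
theorem card_le_of_certificate3 (s : ℝ) (C : Finset (EuclideanSpace ℝ (Fin 3)))
    (hC : ∀ x ∈ C, ‖x‖ = 1) (hcode : ∀ x ∈ C, ∀ y ∈ C, x ≠ y → inner ℝ x y ≤ s)
    (deg : ℕ) (a : ℕ → ℝ) (ha : ∀ k, 0 ≤ a k)
    (K R : ℕ) (d : ℕ → ℕ → ℝ) (hd : ∀ k r, 0 ≤ d k r) (g : ℕ → ℕ → ℝ → ℝ)
    (b11 b12 b22 : ℝ) (hb11 : 0 ≤ b11) (hb22 : 0 ≤ b22) (hdet : b12 ^ 2 ≤ b11 * b22)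
    (h1 : ∀ u : ℝ, -1 ≤ u → u ≤ s →
      (∑ k ∈ range (deg + 1), a k * gegenbauerSum ((((3 : ℕ) : ℝ) - 2) / 2) k u)
        + 3 * threePointF3 K R d g u u 1 ≤ -1 - 2 * b12 - b22)
    (h2 : ∀ u v t : ℝ, -1 ≤ u → u ≤ s → -1 ≤ v → v ≤ s → -1 ≤ t → t ≤ s →
      0 ≤ 1 + 2 * u * v * t - u ^ 2 - v ^ 2 - t ^ 2 → threePointF3 K R d g u v t ≤ -b22)
    (hpos : 0 ≤ 1 + (∑ k ∈ range (deg + 1), a k * gegenbauerSum ((((3 : ℕ) : ℝ) - 2) / 2) k 1)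
      + b11 + threePointF3 K R d g 1 1 1) :
    (C.card : ℝ) ≤ 1 + (∑ k ∈ range (deg + 1), a k * gegenbauerSum ((((3 : ℕ) : ℝ) - 2) / 2) k 1)
      + b11 + threePointF3 K R d g 1 1 1 :=
  card_le_of_threePoint s C hC hcode
    (fun u => ∑ k ∈ range (deg + 1), a k * gegenbauerSum ((((3 : ℕ) : ℝ) - 2) / 2) k u)
    (threePointF3 K R d g) b11 b12 b22
    (pairSum_gegenbauer_comb_nonneg (n := 3) (by norm_num) deg a ha C hC)
    (tripleSum_threePointF3_nonneg K R d hd g C hC)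
    (fun u v t => threePointF3_swap12 K R d g u v t)
    (fun u v t => threePointF3_swap23 K R d g u v t)
    (quad_nonneg_of_psd2 b11 b12 b22 hb11 hb22 hdet) h1 h2 hpos

/-- **Integer form of Theorem 4.2 on `S²`:** under the hypotheses of `card_le_of_certificate3`,
if the bound is `< N + 1` then `|C| ≤ N`, i.e. `A(3, arccos s) ≤ N`; with `s = cos θ` and
`N' = N` points this is how an upper bound `θ(N+1) ≤ θ` for the Tammes problem is certified.
[cite: BachocVallentin2007, Theorem 4.2] -/
theorem card_le_of_certificate3_int (s : ℝ) (C : Finset (EuclideanSpace ℝ (Fin 3)))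
    (hC : ∀ x ∈ C, ‖x‖ = 1) (hcode : ∀ x ∈ C, ∀ y ∈ C, x ≠ y → inner ℝ x y ≤ s)
    (deg : ℕ) (a : ℕ → ℝ) (ha : ∀ k, 0 ≤ a k)
    (K R : ℕ) (d : ℕ → ℕ → ℝ) (hd : ∀ k r, 0 ≤ d k r) (g : ℕ → ℕ → ℝ → ℝ)
    (b11 b12 b22 : ℝ) (hb11 : 0 ≤ b11) (hb22 : 0 ≤ b22) (hdet : b12 ^ 2 ≤ b11 * b22)
    (h1 : ∀ u : ℝ, -1 ≤ u → u ≤ s →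
      (∑ k ∈ range (deg + 1), a k * gegenbauerSum ((((3 : ℕ) : ℝ) - 2) / 2) k u)
        + 3 * threePointF3 K R d g u u 1 ≤ -1 - 2 * b12 - b22)
    (h2 : ∀ u v t : ℝ, -1 ≤ u → u ≤ s → -1 ≤ v → v ≤ s → -1 ≤ t → t ≤ s →
      0 ≤ 1 + 2 * u * v * t - u ^ 2 - v ^ 2 - t ^ 2 → threePointF3 K R d g u v t ≤ -b22)
    (N : ℕ) (hN0 : 0 ≤ 1 + (∑ k ∈ range (deg + 1), a k * gegenbauerSum ((((3 : ℕ) : ℝ) - 2) / 2) k 1)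
      + b11 + threePointF3 K R d g 1 1 1)
    (hN : 1 + (∑ k ∈ range (deg + 1), a k * gegenbauerSum ((((3 : ℕ) : ℝ) - 2) / 2) k 1)
      + b11 + threePointF3 K R d g 1 1 1 < (N : ℝ) + 1) :
    C.card ≤ N := by
  have h := card_le_of_certificate3 s C hC hcode deg a ha K R d hd g b11 b12 b22 hb11 hb22 hdet
    h1 h2 hN0
  have hlt : (C.card : ℝ) < (N : ℝ) + 1 := lt_of_le_of_lt h hN
  have hlt' : C.card < N + 1 := by exact_mod_cast hlt
  omega

end BachocVallentin

end Literature.Geometry.DiscreteGeometry
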